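import Mathlib

/-!
# `HyperbolicEnd` (stmt-SmoothPoincare4-7825), line `Sketch`, negative side
## Line test against the flat weight `exp(-β re z)`

Helper for the negative side of the line (`Theorems/HyperbolicEnd/Negative/`: frozen-J
certificate filling fails in complex dimension one). Statement registered on the crux item
(stub helper_expWeightTest); it is used with `β = 1` by the neck non-fillability helper.

**The test.** Let `λ` be `C²` near `w` with `λ(w) > 0`, `c' > 0` and
`2c' λ³ ≤ λ Δλ - |∇λ|²` at `w`.  Then `Q(z) = λ(z) exp(-β re z)` has no local maximum at `w`:
the weight `exp(-β re z)` is the density of a flat metric, and a density of curvature `≤ -c' < 0`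
cannot touch it from below.  Concretely, if `w` were a local maximum, restricting `Q` to the two
real lines `t ↦ w + t` and `t ↦ w + tI` and writing out the first- and second-order conditions at
`t = 0` (`line_test`, with the weight `exp(a + b t)` along the line, `b = -β re v`) gives, with
`L = λ(w)`, `p = ∂ₓλ`, `q = ∂_yλ`, `s = ∂ₓₓλ`, `u = ∂_yyλ` at `w`:
`p = βL`, `q = 0`, `s ≤ 2βp - β²L = β²L`, `u ≤ 0`; combined with `Δλ = s + u` the curvature
inequality yields `2c'L³ ≤ L(s + u) - (p² + q²) ≤ β²L² - β²L² = 0`, contradicting `c', L > 0`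
(`algebra_step`).  The one-variable calculus along real lines is copied from the sibling
`Theorems/HyperbolicEnd/Negative/NeckLineTest.lean` (weight `cos²` replaced by `exp`).
-/

noncomputable section

-- the prescribed namespace `Summit.<P>.<Sub>.…` duplicates `SmoothPoincare4` (P = Sub)
set_option linter.dupNamespace false

open scoped ContDiff Topology Real
open Laplacian Set Filter Metric Complex

namespace Summit.SmoothPoincare4.SmoothPoincare4.Theorems.HyperbolicEnd.Negative

/-! ### One-variable calculus along real lines in `ℂ` (local versions) -/

/-- Derivative of `f : ℂ → F` along the real line `t ↦ z + t • v` at a parameter `t` where `f` is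
differentiable (copied from `NeckLineTest.lean`). -/
private theorem hasDerivAt_line {F : Type*} [NormedAddCommGroup F] [NormedSpace ℝ F]
    {f : ℂ → F} (z v : ℂ) (t : ℝ) (hf : DifferentiableAt ℝ f (z + t • v)) :
    HasDerivAt (fun s : ℝ => f (z + s • v)) (fderiv ℝ f (z + t • v) v) t := by
  have hl : HasDerivAt (fun s : ℝ => z + s • v) v t := by
    simpa using ((hasDerivAt_id t).smul_const v).const_add z
  exact hf.hasFDerivAt.comp_hasDerivAt t hl

/-- Second derivative along the line: for `f` of class `C²` at `z`, `t ↦ Df(z + t v) v` has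
derivative `D²f(z)(v, v)` at `t = 0` (copied from `NeckLineTest.lean`). -/
private theorem hasDerivAt_line_fderiv {f : ℂ → ℝ} {z : ℂ} (hf : ContDiffAt ℝ 2 f z) (v : ℂ) :
    HasDerivAt (fun s : ℝ => fderiv ℝ f (z + s • v) v) (fderiv ℝ (fderiv ℝ f) z v v) 0 := by
  have hD : DifferentiableAt ℝ (fderiv ℝ f) z :=
    (hf.fderiv_right (m := 1) (by norm_num)).differentiableAt one_ne_zero
  have hl : HasDerivAt (fun s : ℝ => z + s • v) v 0 := by
    simpa using ((hasDerivAt_id (0 : ℝ)).smul_const v).const_add z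
  have hD' : HasFDerivAt (fderiv ℝ f) (fderiv ℝ (fderiv ℝ f) z) (z + (0 : ℝ) • v) := by
    rw [zero_smul, add_zero]
    exact hD.hasFDerivAt
  have h1 : HasDerivAt (fun s : ℝ => fderiv ℝ f (z + s • v)) (fderiv ℝ (fderiv ℝ f) z v) 0 :=
    hD'.comp_hasDerivAt (0 : ℝ) hl
  have h2 := h1.clm_apply (hasDerivAt_const (0 : ℝ) v)
  simpa using h2

/-- A function of class `C²` at `z` is differentiable at the points `z + t v` for `t` near `0`
(copied from `NeckLineTest.lean`). -/
private theorem eventually_differentiableAt_line {f : ℂ → ℝ} {z : ℂ} (hf : ContDiffAt ℝ 2 f z)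
    (v : ℂ) : ∀ᶠ t in 𝓝 (0 : ℝ), DifferentiableAt ℝ f (z + t • v) := by
  have hev : ∀ᶠ y in 𝓝 z, ContDiffAt ℝ 2 f y := hf.eventually (by simp)
  have hl : Continuous fun s : ℝ => z + s • v := by fun_prop
  have ht : Tendsto (fun s : ℝ => z + s • v) (𝓝 0) (𝓝 z) := by
    simpa using hl.tendsto 0
  exact (ht.eventually hev).mono fun t ht => ht.differentiableAt two_ne_zero

/-- One-dimensional second-derivative test, necessary form: at a local maximum where `φ` is
continuous, `φ'' ≤ 0` (otherwise the sufficient second-derivative test makes the point also a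
local minimum, `φ` is locally constant and `φ'' = 0` there). Copied from `NeckLineTest.lean`. -/
private theorem deriv_deriv_nonpos_of_isLocalMax {φ : ℝ → ℝ} {t₀ : ℝ} (h : IsLocalMax φ t₀)
    (hc : ContinuousAt φ t₀) : deriv (deriv φ) t₀ ≤ 0 := by
  by_contra hpos
  have hpos' : 0 < deriv (deriv φ) t₀ := lt_of_not_ge hpos
  have hmin : IsLocalMin φ t₀ := isLocalMin_of_deriv_deriv_pos hpos' h.deriv_eq_zero hc
  have heq : φ =ᶠ[𝓝 t₀] fun _ => φ t₀ :=
    (h.and hmin).mono fun s hs => le_antisymm hs.1 hs.2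
  have h2 : deriv (deriv φ) t₀ = deriv (deriv fun _ : ℝ => φ t₀) t₀ := heq.deriv.deriv_eq
  rw [h2] at hpos'
  simp at hpos'

/-- First- and second-order conditions at a local maximum, for a function with a derivative `ψ'`
near the point which is itself differentiable at the point: `ψ'(t₀) = 0` and `ψ''(t₀) ≤ 0`
(copied from `NeckLineTest.lean`). -/
private theorem deriv_test {ψ ψ' : ℝ → ℝ} {d t₀ : ℝ} (hψ : ∀ᶠ t in 𝓝 t₀, HasDerivAt ψ (ψ' t) t)
    (hψ' : HasDerivAt ψ' d t₀) (hmax : IsLocalMax ψ t₀) : ψ' t₀ = 0 ∧ d ≤ 0 := by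
  have h0 : HasDerivAt ψ (ψ' t₀) t₀ := hψ.self_of_nhds
  have h1 : deriv ψ =ᶠ[𝓝 t₀] ψ' := hψ.mono fun t ht => ht.deriv
  refine ⟨hmax.hasDerivAt_eq_zero h0, ?_⟩
  have h2 : deriv (deriv ψ) t₀ = d := by
    rw [h1.deriv_eq]
    exact hψ'.deriv
  rw [← h2]
  exact deriv_deriv_nonpos_of_isLocalMax hmax h0.continuousAt

/-! ### The flat weight along a line -/

/-- Derivative of the weight `s ↦ exp(a + b s)`. -/
private theorem hasDerivAt_weight (a b t : ℝ) :
    HasDerivAt (fun s : ℝ => Real.exp (a + b * s)) (b * Real.exp (a + b * t)) t := by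
  have hθ : HasDerivAt (fun s : ℝ => a + b * s) b t := by
    simpa using ((hasDerivAt_id t).const_mul b).const_add a
  refine hθ.exp.congr_deriv ?_
  ring

/-- Derivative of `s ↦ b exp(a + b s)`, the derivative of the weight. -/
private theorem hasDerivAt_weight' (a b t : ℝ) :
    HasDerivAt (fun s : ℝ => b * Real.exp (a + b * s)) (b ^ 2 * Real.exp (a + b * t)) t := by
  refine ((hasDerivAt_weight a b t).const_mul b).congr_deriv ?_
  ring

/-! ### The line test at a local maximum of `f · exp(-β re z)` -/

/-- **Line test.** At a local maximum `z` of `w ↦ f(w) exp(-β re w)` (`f` of class `C²` at `z`),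
the first derivative of the restriction to the real line `t ↦ z + t v` vanishes and the second
one is `≤ 0`; written out with `E = exp(-β re z)` and `b = -β re v` (so that the weight along
the line is `exp(-β re z + b t)` with first derivative `bE` and second derivative `b²E` at
`t = 0`). -/
private theorem line_test {f : ℂ → ℝ} {z : ℂ} (hf : ContDiffAt ℝ 2 f z) {β : ℝ}
    (hmax : IsLocalMax (fun w => f w * Real.exp (-(β * w.re))) z) (v : ℂ) :
    fderiv ℝ f z v * Real.exp (-(β * z.re)) +
        f z * (-(β * v.re) * Real.exp (-(β * z.re))) = 0 ∧
      fderiv ℝ (fderiv ℝ f) z v v * Real.exp (-(β * z.re)) +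
          fderiv ℝ f z v * (-(β * v.re) * Real.exp (-(β * z.re))) +
        (fderiv ℝ f z v * (-(β * v.re) * Real.exp (-(β * z.re))) +
          f z * ((-(β * v.re)) ^ 2 * Real.exp (-(β * z.re)))) ≤ 0 := by
  set a : ℝ := -(β * z.re) with ha
  set b : ℝ := -(β * v.re) with hb
  -- the restriction of the weight to the line is `exp(a + b t)`
  have hfun : (fun s : ℝ => f (z + s • v) * Real.exp (-(β * (z + s • v).re))) =
      fun s => f (z + s • v) * Real.exp (a + b * s) := by
    funext s
    simp only [ha, hb, Complex.add_re, Complex.smul_re, smul_eq_mul]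
    ring_nf
  -- the restriction has a local maximum at `0`
  have hmax0 : IsLocalMax (fun s : ℝ => f (z + s • v) * Real.exp (-(β * (z + s • v).re))) 0 := by
    have hz : IsLocalMax (fun w => f w * Real.exp (-(β * w.re))) ((fun s : ℝ => z + s • v) 0) := by
      simpa using hmax
    exact hz.comp_continuous (g := fun s : ℝ => z + s • v) (by fun_prop)
  rw [hfun] at hmax0
  -- derivatives along the line
  have hf1 : ∀ᶠ t in 𝓝 (0 : ℝ),
      HasDerivAt (fun s : ℝ => f (z + s • v)) (fderiv ℝ f (z + t • v) v) t :=
    (eventually_differentiableAt_line hf v).mono fun t ht => hasDerivAt_line z v t ht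
  have hf10 : HasDerivAt (fun s : ℝ => f (z + s • v)) (fderiv ℝ f (z + (0 : ℝ) • v) v) 0 :=
    hf1.self_of_nhds
  have hf2 := hasDerivAt_line_fderiv hf v
  have hψ : ∀ᶠ t in 𝓝 (0 : ℝ), HasDerivAt (fun s : ℝ => f (z + s • v) * Real.exp (a + b * s))
      (fderiv ℝ f (z + t • v) v * Real.exp (a + b * t) +
        f (z + t • v) * (b * Real.exp (a + b * t))) t :=
    hf1.mono fun t ht => ht.fun_mul (hasDerivAt_weight a b t)
  have hψ' := (hf2.fun_mul (hasDerivAt_weight a b 0)).fun_add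
    (hf10.fun_mul (hasDerivAt_weight' a b 0))
  obtain ⟨h1, h2⟩ := deriv_test hψ hψ' hmax0
  simp only [zero_smul, add_zero, mul_zero] at h1 h2
  exact ⟨h1, h2⟩

/-! ### The pointwise algebra -/

/-- **The pointwise algebra**: with `L = λ(w) > 0`, `E = exp(-β re w) > 0`, `c > 0`, the
first-order relation in the direction `1` (`pE = βLE`), the two second-order inequalities
(`sE ≤ 2βpE - β²LE`, `uE ≤ 0`) and the curvature hypothesis are contradictory:
`2cL³E ≤ (L(s + u) - p² - q²)E ≤ 2β²L²E - β²L²E - β²L²E - q²E ≤ 0 < 2cL³E`. -/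
private theorem algebra_step {c L E β p q s u : ℝ} (hL : 0 < L) (hE : 0 < E) (hc : 0 < c)
    (ha1 : p * E = β * L * E)
    (hb1 : s * E ≤ 2 * β * p * E - β ^ 2 * L * E)
    (hb2 : u * E ≤ 0)
    (hd : 2 * c * L ^ 3 ≤ L * (s + u) - (p ^ 2 + q ^ 2)) : False := by
  -- multiply the curvature inequality by `E > 0` and the second-order ones by `L > 0`
  have i1 : 2 * c * L ^ 3 * E ≤ (L * (s + u) - (p ^ 2 + q ^ 2)) * E :=
    mul_le_mul_of_nonneg_right hd hE.le
  have i2 : L * (s * E) ≤ L * (2 * β * p * E - β ^ 2 * L * E) :=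
    mul_le_mul_of_nonneg_left hb1 hL.le
  have i3 : L * (u * E) ≤ L * 0 := mul_le_mul_of_nonneg_left hb2 hL.le
  -- the first-order relation, used quadratically
  have e1 : p ^ 2 * E = β ^ 2 * L ^ 2 * E := by
    linear_combination (p + β * L) * ha1
  have e2 : L * (2 * β * p * E) = 2 * β ^ 2 * L ^ 2 * E := by
    linear_combination (2 * β * L) * ha1
  have hq : 0 ≤ q ^ 2 * E := by positivity
  have hpos : 0 < 2 * c * L ^ 3 * E := by positivity
  nlinarith [i1, i2, i3, e1, e2, hq, hpos]

/-! ### The helper -/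

/-- helper (negative side): line test against the flat weight `exp(-β re z)`.  For `λ` of class
`C²` at `w` with `λ(w) > 0`, `c' > 0` and the curvature inequality `2c'λ³ ≤ λΔλ - |∇λ|²` at `w`,
the product `Q = λ · exp(-β re z)` has no local maximum at `w` (a density of curvature `≤ -c' < 0`
cannot touch the flat density `exp(-β re z)` from below). -/
theorem helper_expWeightTest : ∀ (lam : ℂ → ℝ) (w : ℂ) (β c' : ℝ), ContDiffAt ℝ 2 lam w →
    0 < lam w → 0 < c' → 2 * c' * lam w ^ 3 ≤
      lam w * (Δ lam) w - ((fderiv ℝ lam w 1) ^ 2 + (fderiv ℝ lam w Complex.I) ^ 2) →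
    ¬ IsLocalMax (fun z => lam z * Real.exp (-(β * z.re))) w := by
  intro lam w β c' hlam hpos hc hineq hmax
  obtain ⟨ha1, hb1⟩ := line_test hlam hmax 1
  obtain ⟨_, hb2⟩ := line_test hlam hmax Complex.I
  simp only [Complex.one_re, mul_one] at ha1 hb1
  simp only [Complex.I_re, mul_zero, neg_zero] at hb2
  have hΔ : (Δ lam) w = fderiv ℝ (fderiv ℝ lam) w 1 1 +
      fderiv ℝ (fderiv ℝ lam) w Complex.I Complex.I := by
    rw [InnerProductSpace.laplacian_eq_iteratedFDeriv_complexPlane lam]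
    simp [iteratedFDeriv_two_apply]
  rw [hΔ] at hineq
  exact algebra_step (c := c') (L := lam w) (E := Real.exp (-(β * w.re))) (β := β)
    (p := fderiv ℝ lam w 1) (q := fderiv ℝ lam w Complex.I)
    (s := fderiv ℝ (fderiv ℝ lam) w 1 1)
    (u := fderiv ℝ (fderiv ℝ lam) w Complex.I Complex.I)
    hpos (Real.exp_pos _) hc (by linear_combination ha1) (by linarith) (by linarith) hineq

end Summit.SmoothPoincare4.SmoothPoincare4.Theorems.HyperbolicEnd.Negative

end
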